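import Summits.BirchSwinnertonDyer.BirchSwinnertonDyer.Theses.UniversalToricDescent
import Summits.BirchSwinnertonDyer.BirchSwinnertonDyer.Theorems.UniversalToricDescentToricTransportModThreeStubRatDescent
import Summits.BirchSwinnertonDyer.BirchSwinnertonDyer.Theorems.UniversalToricDescentThinCombDefs
import Summits.BirchSwinnertonDyer.BirchSwinnertonDyer.Theorems.UniversalToricDescentThinCombWeakReflection
import Summits.BirchSwinnertonDyer.BirchSwinnertonDyer.Theorems.UniversalToricDescentAdditiveSplitIMCInclusionAtThreeStubCharIdealPrincipal
import Summits.BirchSwinnertonDyer.BirchSwinnertonDyer.Theorems.UniversalToricDescentAdditiveSplitIMCInclusionAtThreeStubFrame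
import Summits.BirchSwinnertonDyer.BirchSwinnertonDyer.Theorems.UniversalToricDescentAdditiveSplitIMCInclusionAtThreeStubTorsionTransfer
import Summits.BirchSwinnertonDyer.BirchSwinnertonDyer.Theorems.UniversalToricDescentThinCombLineValue
import Summits.BirchSwinnertonDyer.BirchSwinnertonDyer.Theorems.UniversalToricDescentThinCombContRigidity
import Summits.BirchSwinnertonDyer.BirchSwinnertonDyer.Theorems.UniversalToricDescentCharIdealVacuity
import Summits.BirchSwinnertonDyer.BirchSwinnertonDyer.Theorems.UniversalToricDescentThinCombNoPseudoNullOfPoitouTate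
import Summits.BirchSwinnertonDyer.BirchSwinnertonDyer.Theorems.UniversalToricDescentToricTransportModThreeNormProfile
import Summits.BirchSwinnertonDyer.BirchSwinnertonDyer.Theorems.SignedBaseChangeAnticyclotomicEisensteinDivisibilityXGrTwoModuleFinite
import Summits.BirchSwinnertonDyer.Rank1Residual.X2.HidaLimitCongruenceAlgebra
import Literature.NumberTheory.EllipticCurves.TwoVariableSelmerDual
import Literature.NumberTheory.EllipticCurves.ZpExtensionSplitPrimeLineThroughPair
import Literature.NumberTheory.EllipticCurves.ToricTwoVariablePAdicLFunctionUpTo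
import Literature.NumberTheory.GaloisCohomology.PoitouTateRestrictedRamificationNaturalAt
import Summits.BirchSwinnertonDyer.BirchSwinnertonDyer.Theorems.EisensteinPrimesPoitouTateShaNaturalAtTC
import Summits.BirchSwinnertonDyer.BirchSwinnertonDyer.Theorems.UniversalToricDescentRatwallThinCombContRigidityUpTo
import Summits.BirchSwinnertonDyer.BirchSwinnertonDyer.Theorems.UniversalToricDescentRatwallThinCombContRigidityUpToTwoGradings
import HarnessLib
import HarnessLib

/-!
# Line `ratwall_thin_comb` v5 on the RATIONAL WALL `RationalSplitIMCInclusionAtThree` (stmt-BirchSwinnertonDyer-24207) — the crux CLOSED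
# MODULO ITS THREE v5 STUBS ONLY, in ♯♯-CURRENCY: K3a♯♯ (∃ toric two-variable function up to a constant and two gradings), K4 ⊕ K3(iii)
# (one weak reflection making `G` and `L₂` symmetric) and K2-rat (rational thin-comb divisibility); NO print input is left
# (helper, `--supports stmt-BirchSwinnertonDyer-24207`; cell `pub/bsd-wall`, LEAD `cruxlead-24207` g3)

WHY v5 (LEAD-CENSUS-g3 §1). At the additive prime `3` of `f` the interpolation formula of the `𝛉`-dominant two-variable `p`-adic `L`-function
carries the local `ε`-factor of the supercuspidal `π_{f,3}` (Hao–Loeffler 2025 Thm. 3.5: `λ_p(g)^b (p^{t+1}/α)^b`, any `p > 2`, any `p`-level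
of the universal-family form; in the toric dictionary `λ^c · ψ(𝔭̄)^{−c}` = constant × unit of `Λ₂` × `3^{c·b}`, graded by `b` ALONE). The
♯-display `IsToricTwoVarLFunctionUpTo C` (one constant, one grading `Ω_p^{2(a+b)}`, `𝓔 = 1` read off the level) cannot absorb it, so v4's
K3a♯ asked for an object that does not exist once one `L`-value of the family is non-zero. v5 frees a second grading —
`Literature…IsToricTwoVarLFunctionUpTo₂ C X Y` (p739474) — and runs the cross-period rigidity in ♯♯-form
(`…RatwallThinComb.ContRigidityUpTo.eq_zero_or_rel_spec_of_toricUpTo₂_values`, p739325); the research content is split along the print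
line into THREE registered stubs (skeleton `Cruxes/RationalSplitIMCInclusionAtThree/Lines/ratwall_thin_comb.lean` v5, sha16 32b357b7c9c8a84d):

* `hK3a` = `stub_toricExistsUpTo2` (∃ ♯♯-frame; PRINT-ADJACENT at `p = 3`: Hao–Loeffler Thm. 3.5 modulo their running hypotheses on
  `Ind ψ̄` and `ρ̄_{E,3}|G_{ℚ₃}`, the Petersson → CM-period renormalisation and `R₀`-integrality after the unit);
* `hSym` = `stub_reflectionSymmetryUpTo2` (∀ ♯♯-frames with `X₂` f.g. torsion: ONE weak reflection `ρ`, `ρ G ∼ G` — Hao–Lim 2026 algebraic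
  functional equation, conditional on their hypothesis (b) — and `ρ L₂ ∼ L₂` — Hao–Loeffler Thm. 4.9; PRINT-ADJACENT);
* `hK2` = `stub_ratCombDvdUpTo2` (∀ ♯♯-frames: `ThinCombDvdRat R₀ 3 G L₂` — the Beilinson–Flach Euler system over the half-ordinary
  universal deformation family; OPEN, Gu 2025 Conj. 2.15).

Also `toricExistsUpTo2_of_toricExistsUpTo`: v4's ∃ ♯-stub implies v5's ∃ ♯♯-stub (`X = Y = Ω_p²`) — the reshape WEAKENS the existence side.
(The ∀-stubs of v5 range over MORE frames than v4's; every ♯♯-frame is constant × unit × any other, so their content is unchanged in substance.)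
TIGHTNESS of the K2-rat ⊕ K4 ⊕ K3(iii) shape: `…ThinComb.RatCombTightness` (p738781). So, as of v5: 24207 = research {K2-rat} ⊕ print-adjacent
{K3a♯♯, K4 ⊕ K3(iii)} ⊕ print {∅}. HONEST FRAMING: conditional (closure.modulo) on three statements for which this file is no evidence; it
credits nothing by itself; no summit statement and no case of BSD is proved; 24207 OPEN.
-/

set_option linter.dupNamespace false
set_option autoImplicit false

noncomputable section

open scoped Classical

namespace Summit.BirchSwinnertonDyer.BirchSwinnertonDyer.Theorems.UniversalToricDescentRatwallThinCombLine

open NumberField IsDedekindDomain Field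
open Literature.NumberTheory.EllipticCurves Literature.NumberTheory.GaloisRepresentations
open Literature.NumberTheory.EllipticCurves.ModularForms
open Summit.BirchSwinnertonDyer.BirchSwinnertonDyer.Theorems.UniversalToricDescentThinComb

/-- **The rational wall from its three v5 stubs ALONE** (skeleton `ratwall_thin_comb` v5, ♯♯-currency): K3a♯♯ `stub_toricExistsUpTo2`,
K4 ⊕ K3(iii) `stub_reflectionSymmetryUpTo2` and K2-rat `stub_ratCombDvdUpTo2` as hypotheses VERBATIM; everything else — frame, principal
generator, torsion dichotomy, ♯♯ cross-period rigidity, line congruence, weak-reflection rigidity, no-pseudo-null (Milne ADT I 4.10 (a) proved in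
the kernel), rational descent — is a tree theorem. Conditional; closes nothing by itself.
[cite: HaoLoeffler2025, Thm. 3.5, Thm. 4.9 (arXiv:2405.12611)] [cite: HaoLim2026AlgebraicFE, §1 main Thm. (c) (arXiv:2601.10426)]
[cite: Gu2025FiniteSlopeUniversalRS, Conj. 2.15 (arXiv:2512.01184)] [cite: CastellaWan2023, §2.4 Thm. 2.11, Cor. 2.12] [cite: MilneADT2006, I Thm. 4.10 (a) (p. 57)] -/
theorem RationalSplitIMCInclusionAtThree_of_toricExistsUpTo2_of_reflectionSymmetry_of_ratCombDvd
    (hK3a :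
        ∀ (W : WeierstrassCurve ℚ) [W.IsElliptic] [W.IsGloballyMinimal] (N : ℕ) [NeZero N] (K : Type) [Field K]
          [NumberField K] (Dt : Literature.NumberTheory.EllipticCurves.ModularForms.ModularParametrizationData W N),
        Summit.BirchSwinnertonDyer.Rank1Residual.Additive.ClassO6 W 3 → W.HasSurjectiveModNGaloisRep 3 →
        W.analyticRank = 1 → W.conductorNorm ℤ = N → IsImaginaryQuadratic K → SatisfiesHeegnerHypothesis N K →
        ∀ (κ : ZpExtension K 3), κ.IsAnticyclotomic → ∀ (γ : Field.absoluteGaloisGroup K) [Fact (κ.IsTopGenerator γ)]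
          (𝔭 : HeightOneSpectrum (𝓞 K)), ((3 : ℕ) : 𝓞 K) ∈ 𝔭.asIdeal →
          𝔭.asIdeal.ramificationIdx (𝓞 ℚ) = 1 → 𝔭.asIdeal.inertiaDeg (𝓞 ℚ) = 1 →
        ∀ (𝔭' : HeightOneSpectrum (𝓞 K)), ((3 : ℕ) : 𝓞 K) ∈ 𝔭'.asIdeal → 𝔭' ≠ 𝔭 →
        ∀ (ι' : PadicAlgCl 3 ≃+* ℂ), Summit.BirchSwinnertonDyer.BirchSwinnertonDyer.Theorems.SchneiderFree.BranchInducesPrime 3 ι' 𝔭 →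
        ∀ (κ₁ κ₂ : ZpExtension K 3) (γ₁ γ₂ : Field.absoluteGaloisGroup K) (k : ℕ)
          [Fact (ZpExtension.IsTopGeneratorPair κ₁ κ₂ γ₁ γ₂)],
        (∀ v : HeightOneSpectrum (𝓞 K), v ≠ 𝔭 → ∀ 𝔓 ∈ v.primesAbove,
            𝔓.inertia (Field.absoluteGaloisGroup K) ≤ κ₁.kerSubgroup) →
        ZpExtension.pairKer κ₁ κ₂ ≤ κ.kerSubgroup → γ₁ * γ⁻¹ ∈ κ.kerSubgroup → γ₂ * (γ ^ (3 ^ k))⁻¹ ∈ κ.kerSubgroup →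
        ∃ (ΩK' : ℂ) (C X Y : ℂ_[3]) (L₂ : PowerSeries (PowerSeries (unrIntegers 3))),
          ΩK' ≠ 0 ∧ C ≠ 0 ∧ X ≠ 0 ∧ Y ≠ 0 ∧
          IsToricTwoVarLFunctionUpTo₂ C X Y ι' 𝔭 𝔭' κ₁ κ₂ γ₁ γ₂ Dt.f ΩK' L₂)
    (hSym :
        ∀ (W : WeierstrassCurve ℚ) [W.IsElliptic] [W.IsGloballyMinimal] (N : ℕ) [NeZero N] (K : Type) [Field K]
          [NumberField K] (Dt : Literature.NumberTheory.EllipticCurves.ModularForms.ModularParametrizationData W N),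
        Summit.BirchSwinnertonDyer.Rank1Residual.Additive.ClassO6 W 3 → W.HasSurjectiveModNGaloisRep 3 →
        W.analyticRank = 1 → W.conductorNorm ℤ = N → IsImaginaryQuadratic K → SatisfiesHeegnerHypothesis N K →
        ∀ (𝔭 : HeightOneSpectrum (𝓞 K)), ((3 : ℕ) : 𝓞 K) ∈ 𝔭.asIdeal →
          𝔭.asIdeal.ramificationIdx (𝓞 ℚ) = 1 → 𝔭.asIdeal.inertiaDeg (𝓞 ℚ) = 1 →
        ∀ (𝔭' : HeightOneSpectrum (𝓞 K)), ((3 : ℕ) : 𝓞 K) ∈ 𝔭'.asIdeal → 𝔭' ≠ 𝔭 →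
        ∀ (ι' : PadicAlgCl 3 ≃+* ℂ), Summit.BirchSwinnertonDyer.BirchSwinnertonDyer.Theorems.SchneiderFree.BranchInducesPrime 3 ι' 𝔭 →
        ∀ (κ₁ κ₂ : ZpExtension K 3) (γ₁ γ₂ : Field.absoluteGaloisGroup K)
          [Fact (ZpExtension.IsTopGeneratorPair κ₁ κ₂ γ₁ γ₂)],
        (∀ v : HeightOneSpectrum (𝓞 K), v ≠ 𝔭 → ∀ 𝔓 ∈ v.primesAbove,
            𝔓.inertia (Field.absoluteGaloisGroup K) ≤ κ₁.kerSubgroup) →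
        Module.Finite (IwasawaAlgebra₂ 3) ((W.baseChange K).XGr₂ 3 κ₁ κ₂ 𝔭' γ₁ γ₂) →
        Module.IsTorsion (IwasawaAlgebra₂ 3) ((W.baseChange K).XGr₂ 3 κ₁ κ₂ 𝔭' γ₁ γ₂) →
        ∀ (g : IwasawaAlgebra₂ 3),
          Literature.NumberTheory.EllipticCurves.Module.charIdeal (IwasawaAlgebra₂ 3)
            ((W.baseChange K).XGr₂ 3 κ₁ κ₂ 𝔭' γ₁ γ₂) = Ideal.span {g} →
        ∀ (ΩK' : ℂ) (C X Y : ℂ_[3]) (L₂ : PowerSeries (PowerSeries (unrIntegers 3))), ΩK' ≠ 0 → C ≠ 0 → X ≠ 0 → Y ≠ 0 →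
          IsToricTwoVarLFunctionUpTo₂ C X Y ι' 𝔭 𝔭' κ₁ κ₂ γ₁ γ₂ Dt.f ΩK' L₂ →
        ∃ (ρ : PowerSeries (PowerSeries (unrIntegers 3)) ≃+* PowerSeries (PowerSeries (unrIntegers 3))),
          (∀ c : unrIntegers 3, ρ (const (unrIntegers 3) c) = const (unrIntegers 3) c) ∧
          ρ (T₂ (unrIntegers 3)) ∉ Ideal.span {const (unrIntegers 3) ((3 : ℕ) : unrIntegers 3), T₂ (unrIntegers 3)} ∧
          Associated (ρ (PowerSeries.map (PowerSeries.map
            (Summit.BirchSwinnertonDyer.Rank1Residual.X11b.Halves.toUnr 3)) g))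
            (PowerSeries.map (PowerSeries.map (Summit.BirchSwinnertonDyer.Rank1Residual.X11b.Halves.toUnr 3)) g) ∧
          Associated (ρ L₂) L₂)
    (hK2 :
        ∀ (W : WeierstrassCurve ℚ) [W.IsElliptic] [W.IsGloballyMinimal] (N : ℕ) [NeZero N] (K : Type) [Field K]
          [NumberField K] (Dt : Literature.NumberTheory.EllipticCurves.ModularForms.ModularParametrizationData W N),
        Summit.BirchSwinnertonDyer.Rank1Residual.Additive.ClassO6 W 3 → W.HasSurjectiveModNGaloisRep 3 →
        W.analyticRank = 1 → W.conductorNorm ℤ = N → IsImaginaryQuadratic K → SatisfiesHeegnerHypothesis N K →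
        ∀ (𝔭 : HeightOneSpectrum (𝓞 K)), ((3 : ℕ) : 𝓞 K) ∈ 𝔭.asIdeal →
          𝔭.asIdeal.ramificationIdx (𝓞 ℚ) = 1 → 𝔭.asIdeal.inertiaDeg (𝓞 ℚ) = 1 →
        ∀ (𝔭' : HeightOneSpectrum (𝓞 K)), ((3 : ℕ) : 𝓞 K) ∈ 𝔭'.asIdeal → 𝔭' ≠ 𝔭 →
        ∀ (ι' : PadicAlgCl 3 ≃+* ℂ), Summit.BirchSwinnertonDyer.BirchSwinnertonDyer.Theorems.SchneiderFree.BranchInducesPrime 3 ι' 𝔭 →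
        ∀ (κ₁ κ₂ : ZpExtension K 3) (γ₁ γ₂ : Field.absoluteGaloisGroup K)
          [Fact (ZpExtension.IsTopGeneratorPair κ₁ κ₂ γ₁ γ₂)],
        (∀ v : HeightOneSpectrum (𝓞 K), v ≠ 𝔭 → ∀ 𝔓 ∈ v.primesAbove,
            𝔓.inertia (Field.absoluteGaloisGroup K) ≤ κ₁.kerSubgroup) →
        Module.Finite (IwasawaAlgebra₂ 3) ((W.baseChange K).XGr₂ 3 κ₁ κ₂ 𝔭' γ₁ γ₂) →
        Module.IsTorsion (IwasawaAlgebra₂ 3) ((W.baseChange K).XGr₂ 3 κ₁ κ₂ 𝔭' γ₁ γ₂) →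
        ∀ (g : IwasawaAlgebra₂ 3),
          Literature.NumberTheory.EllipticCurves.Module.charIdeal (IwasawaAlgebra₂ 3)
            ((W.baseChange K).XGr₂ 3 κ₁ κ₂ 𝔭' γ₁ γ₂) = Ideal.span {g} →
        ∀ (ΩK' : ℂ) (C X Y : ℂ_[3]) (L₂ : PowerSeries (PowerSeries (unrIntegers 3))), ΩK' ≠ 0 → C ≠ 0 → X ≠ 0 → Y ≠ 0 →
          IsToricTwoVarLFunctionUpTo₂ C X Y ι' 𝔭 𝔭' κ₁ κ₂ γ₁ γ₂ Dt.f ΩK' L₂ →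
        ThinCombDvdRat (unrIntegers 3) 3
          (PowerSeries.map (PowerSeries.map (Summit.BirchSwinnertonDyer.Rank1Residual.X11b.Halves.toUnr 3)) g) L₂) :
    Summit.BirchSwinnertonDyer.BirchSwinnertonDyer.Theses.UniversalToricDescent.RationalSplitIMCInclusionAtThree := by
  intro W _ _ N _ K _ _ Dt hO6 hsurj hrk hN hK hH κ hκ γ hγ 𝔭 h3 hram hdeg 𝔭' h3' hne ι' hι ΩK Ωp L hΩK hΩp hL
  obtain ⟨κ₁, κ₂, γ₁, γ₂, k, hpair, hur₁, hker, hγ₁, hγ₂⟩ :=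
    Summit.BirchSwinnertonDyer.BirchSwinnertonDyer.Theorems.UniversalToricDescentThinCombLine.stub_frame
      K hK κ hκ γ hγ.out 𝔭 h3 𝔭' h3' hne
  haveI : Fact (ZpExtension.IsTopGeneratorPair κ₁ κ₂ γ₁ γ₂) := ⟨hpair⟩
  obtain ⟨g₂, hg₂⟩ :=
    Summit.BirchSwinnertonDyer.BirchSwinnertonDyer.Theorems.UniversalToricDescentThinCombLine.stub_charIdealPrincipal
      ((W.baseChange K).XGr₂ 3 κ₁ κ₂ 𝔭' γ₁ γ₂)
  have hg₂' : Literature.NumberTheory.EllipticCurves.Module.charIdeal (IwasawaAlgebra₂ 3)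
      ((W.baseChange K).XGr₂ 3 κ₁ κ₂ 𝔭' γ₁ γ₂) = Ideal.span {g₂} := by
    simpa [Ideal.submodule_span_eq] using hg₂
  have hfin : Module.Finite (IwasawaAlgebra₂ 3) ((W.baseChange K).XGr₂ 3 κ₁ κ₂ 𝔭' γ₁ γ₂) :=
    Summit.BirchSwinnertonDyer.BirchSwinnertonDyer.Theorems.SignedBaseChangeAcDivFinitePiece.xGr₂_module_finite
      (W.baseChange K) 3 κ₁ κ₂ 𝔭'
  -- K3a♯♯: a toric two-variable function up to a non-zero constant and two independent gradings
  obtain ⟨ΩK', C, X, Y, L₂, hΩK', hC, hX, hY, hL₂⟩ :=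
    hK3a W N K Dt hO6 hsurj hrk hN hK hH κ hκ γ 𝔭 h3 hram hdeg 𝔭' h3' hne ι' hι κ₁ κ₂ γ₁ γ₂ k
      hur₁ hker hγ₁ hγ₂
  -- ♯♯ cross-period rigidity WITHOUT the Rankin–Selberg continuation: `L = 0` or `3^a·spec (3^k) L₂ = 3^b·(w·L)`
  rcases Summit.BirchSwinnertonDyer.BirchSwinnertonDyer.Theorems.UniversalToricDescentRatwallThinComb.ContRigidityUpTo.eq_zero_or_rel_spec_of_toricUpTo₂_values
      K N Dt.f hK κ hκ γ hγ.out 𝔭 h3 𝔭' h3' hne ι' κ₁ κ₂ γ₁ γ₂ k hpair hγ₁ hγ₂ hΩK hΩp hL hΩK' hC hX hY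
      (fun ψ a b ha hb hinf hunr r hr hκr Lc hLd hLe ↦ hL₂.hasValueAt₂ ha hb hinf hunr hr hκr hLd hLe) with h0 | ⟨a₀, b₀, w, hw, hrel⟩
  · exact ⟨0, by rw [h0, mul_zero]; exact Ideal.zero_mem _⟩
  -- TORSION DICHOTOMY: off the torsion locus of `X₂` the rational inclusion is trivial (`Ch_Λ(X_ac) = ⊤`)
  by_cases htors : Module.IsTorsion (IwasawaAlgebra₂ 3) ((W.baseChange K).XGr₂ 3 κ₁ κ₂ 𝔭' γ₁ γ₂)
  swap
  · have hnt := Summit.BirchSwinnertonDyer.BirchSwinnertonDyer.Theorems.UniversalToricDescentThinCombLine.stub_torsionTransfer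
      W K hO6 hsurj hK κ hκ γ 𝔭 h3 𝔭' h3' hne κ₁ κ₂ γ₁ γ₂ k hur₁ hker hγ₁ hγ₂ htors
    refine ⟨0, ?_⟩
    rw [pow_zero, one_mul]
    exact (Ideal.span_singleton_le_iff_mem _).mp
      (Summit.BirchSwinnertonDyer.BirchSwinnertonDyer.Theorems.UniversalToricDescentCharIdealVacuity.span_le_map_charIdeal_of_not_isTorsion
        hnt _ L)
  -- the comparison clause of v1 HOLDS for `L♮ := spec (3^k) L₂` with `u = 1`, `t = s = 0`
  have hcmp : ∃ (u : (PowerSeries (PowerSeries (unrIntegers 3)))ˣ) (t s : ℕ),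
      const (unrIntegers 3) (((3 : ℕ) : unrIntegers 3) ^ t) * L₂ -
        u * const (unrIntegers 3) (((3 : ℕ) : unrIntegers 3) ^ s) *
          PowerSeries.map (PowerSeries.C (R := unrIntegers 3)) (TwoVarSubst.spec (3 ^ k) L₂) ∈
        Ideal.span {T₂ (unrIntegers 3) - ((1 + T₁ (unrIntegers 3)) ^ (3 ^ k) - 1)} := by
    refine ⟨1, 0, 0, ?_⟩
    rw [pow_zero, map_one, one_mul, mul_one]
    exact LineValue.sub_one_mul_map_spec_mem_lineIdeal (3 ^ k) L₂
  -- K4 ⊕ K3(iii): ONE weak reflection making both `G` and the pinned `L₂` symmetric up to units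
  obtain ⟨ρ, hρc, hρT, hGsym, hLsym⟩ :=
    hSym W N K Dt hO6 hsurj hrk hN hK hH 𝔭 h3 hram hdeg 𝔭' h3' hne ι' hι κ₁ κ₂ γ₁ γ₂
      hur₁ hfin htors g₂ hg₂' ΩK' C X Y L₂ hΩK' hC hX hY hL₂
  -- K2-rat: rational thin-comb divisibility for the pinned `L₂`
  have hcomb :=
    hK2 W N K Dt hO6 hsurj hrk hN hK hH 𝔭 h3 hram hdeg 𝔭' h3' hne ι' hι κ₁ κ₂ γ₁ γ₂
      hur₁ hfin htors g₂ hg₂' ΩK' C X Y L₂ hΩK' hC hX hY hL₂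
  haveI := Summit.BirchSwinnertonDyer.Rank1Residual.X2.HidaLimitAlgebra.isDiscreteValuationRing_unrIntegers (p := 3)
  have hmax : IsLocalRing.maximalIdeal (unrIntegers 3) = Ideal.span {((3 : ℕ) : unrIntegers 3)} :=
    (IsDiscreteValuationRing.irreducible_iff_uniformizer _).mp
      Summit.BirchSwinnertonDyer.Rank1Residual.X2.HidaLimitAlgebra.irreducible_natCast_p
  obtain ⟨a, hdvd⟩ := dvd_pow_mul_of_weakReflection (unrIntegers 3) 3 hmax ρ hρc hρT _ L₂ hGsym hLsym hcomb
  have hPN :=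
    Summit.BirchSwinnertonDyer.BirchSwinnertonDyer.Theorems.UniversalToricDescentThinComb.NoPseudoNullOfPoitouTate.stub_noPseudoNull_of_poitouTateAt
      Summit.BirchSwinnertonDyer.BirchSwinnertonDyer.Theorems.PoitouTateShaNaturalAtTC.forall_poitouTate_shaRestricted_tateDual_natural_at_of_isTotallyComplex
      W K hO6 hsurj hK κ hκ γ 𝔭 h3 𝔭' h3' hne κ₁ κ₂ γ₁ γ₂ k hur₁ hker hγ₁ hγ₂ hfin htors
  obtain ⟨k', hk'⟩ :=
    Summit.BirchSwinnertonDyer.BirchSwinnertonDyer.Cruxes.ToricTransportModThree.RatwallThinComb.stub_ratDescent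
      W K hO6 hsurj hK κ hκ γ 𝔭 h3 𝔭' h3' hne κ₁ κ₂ γ₁ γ₂ k hur₁ hker hγ₁ hγ₂ hfin htors hPN g₂ hg₂' L₂
      (TwoVarSubst.spec (3 ^ k) L₂) a hdvd hcmp
  -- transport from `L♮ = spec (3^k) L₂` to the handed frame along `3^a·L♮ = 3^b·(w·L)`: slack `k' + b`
  exact ⟨k' + b₀,
    Summit.BirchSwinnertonDyer.BirchSwinnertonDyer.Theorems.UniversalToricDescentRatwallThinComb.ContRigidityUpTo.pow_mul_mem_of_rel
      hw hrel hk'⟩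

/-- **v4 ⇒ v5 on the existence side**: a ♯-frame (`IsToricTwoVarLFunctionUpTo C … Ω_p′ L₂`, v4's `stub_toricExistsUpTo`) is a ♯♯-frame
with `X = Y = Ω_p′²` (`IsToricTwoVarLFunctionUpTo.upTo₂`), so v4's existence stub implies v5's `stub_toricExistsUpTo2` verbatim: the v5
reshape WEAKENS what is asked of the analytic side. [cite: CastellaWan2023, §2.4 Thm. 2.11 (arXiv:1607.02019)] [cite: HaoLoeffler2025, Thm. 3.5 (arXiv:2405.12611)] -/
theorem toricExistsUpTo2_of_toricExistsUpTo
    (hK3a :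
        ∀ (W : WeierstrassCurve ℚ) [W.IsElliptic] [W.IsGloballyMinimal] (N : ℕ) [NeZero N] (K : Type) [Field K]
          [NumberField K] (Dt : Literature.NumberTheory.EllipticCurves.ModularForms.ModularParametrizationData W N),
        Summit.BirchSwinnertonDyer.Rank1Residual.Additive.ClassO6 W 3 → W.HasSurjectiveModNGaloisRep 3 →
        W.analyticRank = 1 → W.conductorNorm ℤ = N → IsImaginaryQuadratic K → SatisfiesHeegnerHypothesis N K →
        ∀ (κ : ZpExtension K 3), κ.IsAnticyclotomic → ∀ (γ : Field.absoluteGaloisGroup K) [Fact (κ.IsTopGenerator γ)]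
          (𝔭 : HeightOneSpectrum (𝓞 K)), ((3 : ℕ) : 𝓞 K) ∈ 𝔭.asIdeal →
          𝔭.asIdeal.ramificationIdx (𝓞 ℚ) = 1 → 𝔭.asIdeal.inertiaDeg (𝓞 ℚ) = 1 →
        ∀ (𝔭' : HeightOneSpectrum (𝓞 K)), ((3 : ℕ) : 𝓞 K) ∈ 𝔭'.asIdeal → 𝔭' ≠ 𝔭 →
        ∀ (ι' : PadicAlgCl 3 ≃+* ℂ), Summit.BirchSwinnertonDyer.BirchSwinnertonDyer.Theorems.SchneiderFree.BranchInducesPrime 3 ι' 𝔭 →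
        ∀ (κ₁ κ₂ : ZpExtension K 3) (γ₁ γ₂ : Field.absoluteGaloisGroup K) (k : ℕ)
          [Fact (ZpExtension.IsTopGeneratorPair κ₁ κ₂ γ₁ γ₂)],
        (∀ v : HeightOneSpectrum (𝓞 K), v ≠ 𝔭 → ∀ 𝔓 ∈ v.primesAbove,
            𝔓.inertia (Field.absoluteGaloisGroup K) ≤ κ₁.kerSubgroup) →
        ZpExtension.pairKer κ₁ κ₂ ≤ κ.kerSubgroup → γ₁ * γ⁻¹ ∈ κ.kerSubgroup → γ₂ * (γ ^ (3 ^ k))⁻¹ ∈ κ.kerSubgroup →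
        ∃ (ΩK' : ℂ) (Ωp' : ℂ_[3]) (C : ℂ_[3]) (L₂ : PowerSeries (PowerSeries (unrIntegers 3))),
          ΩK' ≠ 0 ∧ Ωp' ≠ 0 ∧ C ≠ 0 ∧ IsToricTwoVarLFunctionUpTo C ι' 𝔭 𝔭' κ₁ κ₂ γ₁ γ₂ Dt.f ΩK' Ωp' L₂) :
        ∀ (W : WeierstrassCurve ℚ) [W.IsElliptic] [W.IsGloballyMinimal] (N : ℕ) [NeZero N] (K : Type) [Field K]
          [NumberField K] (Dt : Literature.NumberTheory.EllipticCurves.ModularForms.ModularParametrizationData W N),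
        Summit.BirchSwinnertonDyer.Rank1Residual.Additive.ClassO6 W 3 → W.HasSurjectiveModNGaloisRep 3 →
        W.analyticRank = 1 → W.conductorNorm ℤ = N → IsImaginaryQuadratic K → SatisfiesHeegnerHypothesis N K →
        ∀ (κ : ZpExtension K 3), κ.IsAnticyclotomic → ∀ (γ : Field.absoluteGaloisGroup K) [Fact (κ.IsTopGenerator γ)]
          (𝔭 : HeightOneSpectrum (𝓞 K)), ((3 : ℕ) : 𝓞 K) ∈ 𝔭.asIdeal →
          𝔭.asIdeal.ramificationIdx (𝓞 ℚ) = 1 → 𝔭.asIdeal.inertiaDeg (𝓞 ℚ) = 1 →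
        ∀ (𝔭' : HeightOneSpectrum (𝓞 K)), ((3 : ℕ) : 𝓞 K) ∈ 𝔭'.asIdeal → 𝔭' ≠ 𝔭 →
        ∀ (ι' : PadicAlgCl 3 ≃+* ℂ), Summit.BirchSwinnertonDyer.BirchSwinnertonDyer.Theorems.SchneiderFree.BranchInducesPrime 3 ι' 𝔭 →
        ∀ (κ₁ κ₂ : ZpExtension K 3) (γ₁ γ₂ : Field.absoluteGaloisGroup K) (k : ℕ)
          [Fact (ZpExtension.IsTopGeneratorPair κ₁ κ₂ γ₁ γ₂)],
        (∀ v : HeightOneSpectrum (𝓞 K), v ≠ 𝔭 → ∀ 𝔓 ∈ v.primesAbove,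
            𝔓.inertia (Field.absoluteGaloisGroup K) ≤ κ₁.kerSubgroup) →
        ZpExtension.pairKer κ₁ κ₂ ≤ κ.kerSubgroup → γ₁ * γ⁻¹ ∈ κ.kerSubgroup → γ₂ * (γ ^ (3 ^ k))⁻¹ ∈ κ.kerSubgroup →
        ∃ (ΩK' : ℂ) (C X Y : ℂ_[3]) (L₂ : PowerSeries (PowerSeries (unrIntegers 3))),
          ΩK' ≠ 0 ∧ C ≠ 0 ∧ X ≠ 0 ∧ Y ≠ 0 ∧
          IsToricTwoVarLFunctionUpTo₂ C X Y ι' 𝔭 𝔭' κ₁ κ₂ γ₁ γ₂ Dt.f ΩK' L₂ := by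
  intro W _ _ N _ K _ _ Dt hO6 hsurj hrk hN hK hH κ hκ γ _ 𝔭 h3 hram hdeg 𝔭' h3' hne ι' hι κ₁ κ₂ γ₁ γ₂ k _ hur₁ hker hγ₁ hγ₂
  obtain ⟨ΩK', Ωp', C, L₂, hΩK', hΩp', hC, hL₂⟩ :=
    hK3a W N K Dt hO6 hsurj hrk hN hK hH κ hκ γ 𝔭 h3 hram hdeg 𝔭' h3' hne ι' hι κ₁ κ₂ γ₁ γ₂ k hur₁ hker hγ₁ hγ₂
  exact ⟨ΩK', C, Ωp' ^ 2, Ωp' ^ 2, L₂, hΩK', hC, pow_ne_zero 2 hΩp', pow_ne_zero 2 hΩp', hL₂.upTo₂⟩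

end Summit.BirchSwinnertonDyer.BirchSwinnertonDyer.Theorems.UniversalToricDescentRatwallThinCombLine

end
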